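import Summits.BirchSwinnertonDyer.Rank1Residual.Partition.Bsdp
import Summits.BirchSwinnertonDyer.Rank1Residual.Additive.SharpenedStatements
import Literature.NumberTheory.EllipticCurves.IrreducibleModPQuadraticTwistProofs
import Literature.NumberTheory.EllipticCurves.Rank1Residual.Typed.Basic
import Literature.NumberTheory.EllipticCurves.Skinner2016.RankZeroPPart
import HarnessLib

/-!
# Route `ErratumRoadFive`, crux `EulerHalfNotRamNoInertSetAtFive` (item stmt-BirchSwinnertonDyer-19715), crux idea
# `ramified-twin-ram-transport` (bsd-idea-9 g14, `Cruxes/EulerHalfNotRamNoInertSetAtFive/Ideas/ramified-twin-ram-transport.md`):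
# the TWIN'S LOWER HALF on the served class is Skinner 2016 Thm. C — the card's third typed statement
# `TwinLowerOfSkinnerC`, as kernel theorems

Cell `bsd-stepL` (run/shared/lean/pub/bsd-stepL/), seat `bsd-line-er5-p1-w8` (D-0154 width seat -w8 gen 8 on crux
19715), `--supports stmt-BirchSwinnertonDyer-19715`. THEOREMS ONLY (no definition, no named fact, no `sorry`).

## What

On an S1b pair `(E, p)` of crux 19715 (`p ≥ 5` the only multiplicative prime, split, `¬ Ram E p`) the registered
line `birth` v17 feeds the rank-`0` twin `E^{(d)}` to the route crux `X11aLowerHalf` (item 19064, OPEN): for a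
Kolyvagin field unramified at every additive prime the twin's only multiplicative prime is `p`, so the twin is an
X11a pair. The idea card ramifies the field at an odd additive POTENTIALLY MULTIPLICATIVE prime `q` of `E`
(`ord_q j < 0`, `p ∤ −ord_q j`): the twin `Wd = Cd • E^{(d)}`, `q ∥ d`, is then MULTIPLICATIVE at `q` with
`ord_q Δ_min(Wd) = −ord_q j(E)`, i.e. `Ram Wd p` (the card's FIRST LEMMA `RamTwistOfPotMultRamified`, Tate's
algorithm at `I*_m` — held by seat -w5, NOT proved here), and the twin's `≥`-half is a THEOREM-SHAPE: Skinner,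
Pacific J. Math. 283 (2016), Thm. C (tree named fact `Skinner2016.thmC_padicValRat_bsd_rank_zero`, row C1 of the
rank-`≤ 1` partition), whose hypotheses the twin meets — `3 ≤ p`; multiplicative at `p` (binder: `p` splits in
the field, so `E^{(d)} ≅ E` over `ℚ_p`); `Wd[p]` irreducible, TRANSPORTED from `E[p]` along the twist
(`WeierstrassCurve.hasIrreducibleModPGaloisRep_quadraticTwist_iff`, Silverman *AEC* X.5 Cor. 5.4: `E^{(d)}[p] ≅
E[p] ⊗ χ_d`) and the change of model (`Mazur1978.hasIrreducibleModPGaloisRep_smul_iff`); the (ram) witness `q`;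
`L(Wd, 1) ≠ 0` (the supply); `Ш(Wd)` finite (Gross–Zagier–Kolyvagin).

## Theorems (namespace `…Theorems.RamifiedTwinRamTransport`)

* `irr_twist_model` — `Irr W p → d ≠ 0 → Cd • W.quadraticTwist d = Wd → Irr Wd p`.
* `twinLowerPrintShape_of_thmC` — Thm. C's printed conclusion for the twin model `Wd`
  (`∃ r : ℚ, L(Wd,1)/Ω = r ∧ ord_p r = ord_p #Ш + ord_p ∏c − 2 ord_p #tors`) from `hSk`, `Irr W p`, the twist
  relation, `Mult Wd p`, `Ram Wd p`, `L(Wd,1) ≠ 0`, `Finite Wd.sha`.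
* `twinLowerOfSkinnerC` — the card's typed statement `TwinLowerOfSkinnerC` LITERALLY (Sketch.lean, evidence #55 on
  the item): `hSk →` (the first lemma `RamTwistOfPotMultRamified`, spelled verbatim as a hypothesis) `→ ∀ W p q d Wd
  Cd, 5 ≤ p → q ≠ 2 → q ≠ p → Irr W p → Addv W q → Additive.PotMult W q → padicValInt q d = 1 → Cd • W^{(d)} = Wd →
  ¬ p ∣ ord_q j → Mult Wd p → L(Wd,1) ≠ 0 → Finite Wd.sha →` print shape.
* `rowC1_twist` — the twin is a ROW-C1 pair at `p` (`RowC1 Wd p`: `r_an = 0`, `3 ≤ p`, multiplicative, (irr), (ram)).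
* `twinBSDp_of_thmC`, `twinMissingPPartAt_of_thmC`, `twinMissingLowerBoundAt_of_thmC` — the same in the S1b
  core's currency: Miller's `BSDp Wd p`, `Typed.MissingPPartAt Wd p` and the LOWER half
  `Typed.MissingLowerBoundAt Wd p` (the slot that v17's `res_pOnlyMultCarrierAtFive_of_printFacts` fills with
  `h₃ = X11aLowerHalf` at an X11a twin), from `hSk` + modularity `hmod` + GZK `hGZK` (conjuncts of the route item
  `PublishedInputsFive`) via `RowC1.bsdp` and the typed bookkeeping `Typed.missingPPartAt_of_bsdp`.

HONEST FRAMING: glue over tree material, CONDITIONAL on the displayed named facts (Skinner 2016 Thm. C is PUB at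
`p ≥ 5`; modularity; GZK); the (ram) witness of the twin and the supply `L(Wd,1) ≠ 0` are BINDERS (the card's first
lemma and `GenusFrameTwistSupply`, neither proved here); this is NOT a registered stub of line `birth` (v17 has
none open) and closes nothing: crux 19715 stays closed modulo its route items, BSD is proved for no curve.
-/

noncomputable section

open scoped Classical

open WeierstrassCurve Literature.NumberTheory.EllipticCurves
  Literature.NumberTheory.EllipticCurves.Rank1Residual
  Literature.NumberTheory.EllipticCurves.Rank1Residual.Typed
  Summit.BirchSwinnertonDyer.Rank1Residual

-- the cell's Theorems namespace repeats the summit name (Summit.<Summit>.<Problem>), as in every sibling file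
set_option linter.dupNamespace false

namespace Summit.BirchSwinnertonDyer.BirchSwinnertonDyer.Theorems.RamifiedTwinRamTransport

/-! ### Irreducibility of `E[p]` passes to any model of a quadratic twist -/

/-- **`E[p]` irreducible ⟹ `Wd[p]` irreducible for any model `Wd = Cd • E^{(d)}` of a quadratic twist**
(`d ≠ 0`): `E^{(d)}[p] ≅ E[p] ⊗ χ_d` (`WeierstrassCurve.hasIrreducibleModPGaloisRep_quadraticTwist_iff`) and
invariance under a change of Weierstrass equation (`Mazur1978.hasIrreducibleModPGaloisRep_smul_iff`).
[cite: SilvermanAEC2009, X.5 Cor. 5.4] -/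
theorem irr_twist_model (W : WeierstrassCurve ℚ) (p : ℕ) [Fact p.Prime] (hirr : Irr W p) {d : ℚ}
    (hd : d ≠ 0) {Wd : WeierstrassCurve ℚ} (Cd : VariableChange ℚ) (hCd : Cd • W.quadraticTwist d = Wd) :
    Irr Wd p := by
  haveI : NeZero (2 : ℚ) := ⟨two_ne_zero⟩
  show Wd.HasIrreducibleModPGaloisRep p
  rw [← hCd, Mazur1978.hasIrreducibleModPGaloisRep_smul_iff]
  exact (W.hasIrreducibleModPGaloisRep_quadraticTwist_iff hd p).mpr hirr

/-- An integer with `q`-adic valuation `1` is non-zero as a rational number. [folklore] -/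
theorem cast_ne_zero_of_padicValInt_eq_one {q : ℕ} {d : ℤ} (hd : padicValInt q d = 1) : (d : ℚ) ≠ 0 := by
  have hd0 : d ≠ 0 := by
    rintro rfl
    simp at hd
  exact_mod_cast hd0

/-! ### Skinner 2016 Thm. C at the twin: the printed shape -/

/-- **The twin's lower half, print shape** (Skinner 2016 Thm. C instantiated at a model `Wd = Cd • E^{(d)}` of a
quadratic twist, `d ≠ 0`): if `E[p]` is irreducible, `3 ≤ p`, `Wd` is multiplicative at `p`, carries a (ram)
witness at `p`, `L(Wd,1) ≠ 0` and `Ш(Wd)` is finite, then `L(Wd,1)/Ω_{Wd}` is a rational `r` with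
`ord_p r = ord_p #Ш(Wd) + ord_p ∏_ℓ c_ℓ(Wd) − 2 ord_p #Wd(ℚ)_tors`. The only step is the transport of (irr)
(`irr_twist_model`). [cite: Skinner2016PacificMC, Thm. C (§1)] [cite: SilvermanAEC2009, X.5 Cor. 5.4] -/
theorem twinLowerPrintShape_of_thmC (hSk : Skinner2016.thmC_padicValRat_bsd_rank_zero)
    (W : WeierstrassCurve ℚ) (p : ℕ) [Fact p.Prime] (hp : 3 ≤ p) (hirr : Irr W p) {d : ℚ} (hd : d ≠ 0)
    (Wd : WeierstrassCurve ℚ) [Wd.IsElliptic] [Wd.IsGloballyMinimal] (Cd : VariableChange ℚ)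
    (hCd : Cd • W.quadraticTwist d = Wd) (hmult : Mult Wd p) (hram : Ram Wd p)
    (hL : Wd.entireLFunction 1 ≠ 0) (hfin : Finite Wd.sha) :
    ∃ r : ℚ, Wd.entireLFunction 1 / (Wd.realPeriodRat : ℂ) = (r : ℂ) ∧
      padicValRat p r = (padicValNat p Wd.shaOrder : ℤ) + padicValNat p Wd.tamagawaProduct -
        2 * padicValNat p Wd.torsionOrder :=
  hSk Wd p hp (Or.inr hmult) (irr_twist_model W p hirr hd Cd hCd) hram hL hfin

/-- **`TwinLowerOfSkinnerC` — the card's third typed statement, LITERALLY** (Sketch.lean of crux idea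
`ramified-twin-ram-transport`, evidence #55 on item 19715): Skinner 2016 Thm. C (`hSk`) and the card's FIRST
LEMMA `RamTwistOfPotMultRamified` (here the hypothesis `hRamTwist`, spelled verbatim: at an odd additive
potentially multiplicative `q` with `q ∥ d`, the twist model `Wd` is multiplicative at `q` with
`ord_q Δ_min(Wd) = −ord_q j(E)`, hence `Ram Wd p` when `p ∤ ord_q j(E)` — Tate's algorithm at `I*_m`; held by
seat -w5, not proved here) give, for every served frame (`5 ≤ p`, `q ≠ 2`, `q ≠ p`, `E[p]` irreducible, `q`
additive potentially multiplicative for `E`, `padicValInt q d = 1`, `Cd • E^{(d)} = Wd`, `p ∤ ord_q j(E)`, `Wd`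
multiplicative at `p`, `L(Wd,1) ≠ 0`, `Ш(Wd)` finite), Thm. C's printed conclusion for `Wd`. Proof: the first
lemma supplies `Ram Wd p`; then `twinLowerPrintShape_of_thmC`.
[cite: Skinner2016PacificMC, Thm. C (§1)] [cite: SilvermanAEC2009, X.5 Cor. 5.4] -/
theorem twinLowerOfSkinnerC (hSk : Skinner2016.thmC_padicValRat_bsd_rank_zero)
    (hRamTwist : ∀ (W : WeierstrassCurve ℚ) [W.IsElliptic] [W.IsGloballyMinimal] (p q : ℕ) [Fact p.Prime]
      [Fact q.Prime] (d : ℤ) (Wd : WeierstrassCurve ℚ) [Wd.IsElliptic] [Wd.IsGloballyMinimal]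
      (Cd : WeierstrassCurve.VariableChange ℚ),
      q ≠ 2 → q ≠ p → Addv W q → Additive.PotMult W q → padicValInt q d = 1 →
      Cd • W.quadraticTwist (d : ℚ) = Wd → ¬ (p : ℤ) ∣ padicValRat q W.j →
      Mult Wd q ∧ padicValInt q Wd.minimalDiscriminantInt = - padicValRat q W.j ∧ Ram Wd p) :
    ∀ (W : WeierstrassCurve ℚ) [W.IsElliptic] [W.IsGloballyMinimal] (p q : ℕ) [Fact p.Prime] [Fact q.Prime]
      (d : ℤ) (Wd : WeierstrassCurve ℚ) [Wd.IsElliptic] [Wd.IsGloballyMinimal] (Cd : WeierstrassCurve.VariableChange ℚ),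
      5 ≤ p → q ≠ 2 → q ≠ p → Irr W p → Addv W q → Additive.PotMult W q → padicValInt q d = 1 →
      Cd • W.quadraticTwist (d : ℚ) = Wd → ¬ (p : ℤ) ∣ padicValRat q W.j → Mult Wd p →
      Wd.entireLFunction 1 ≠ 0 → Finite Wd.sha →
      ∃ r : ℚ, Wd.entireLFunction 1 / (Wd.realPeriodRat : ℂ) = (r : ℂ) ∧
        padicValRat p r = (padicValNat p Wd.shaOrder : ℤ) + padicValNat p Wd.tamagawaProduct -
          2 * padicValNat p Wd.torsionOrder := by
  intro W _ _ p q _ _ d Wd _ _ Cd hp hq2 hqp hirr hadd hpot hd hCd hndvd hmult hL hfin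
  obtain ⟨-, -, hram⟩ := hRamTwist W p q d Wd Cd hq2 hqp hadd hpot hd hCd hndvd
  exact twinLowerPrintShape_of_thmC hSk W p (by omega) hirr (cast_ne_zero_of_padicValInt_eq_one hd) Wd Cd
    hCd hmult hram hL hfin

/-! ### The same in the S1b core's currency: the twin is a row-C1 pair, so `BSDp` / `MissingPPartAt` /
`MissingLowerBoundAt` hold for it -/

/-- **The ramified twin is a ROW-C1 pair at `p`** (`RowC1 Wd p`: analytic rank `0`, `3 ≤ p`, multiplicative at
`p`, (irr), (ram)): `L(Wd,1) ≠ 0` gives `r_an(Wd) = 0` unconditionally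
(`analyticRank_eq_zero_of_entireLFunction_one_ne_zero`), (irr) is transported (`irr_twist_model`), the rest are
binders. [cite: Skinner2016PacificMC, Thm. C (§1)] [cite: SilvermanAEC2009, X.5 Cor. 5.4] -/
theorem rowC1_twist (W : WeierstrassCurve ℚ) (p : ℕ) [Fact p.Prime] (hp : 3 ≤ p) (hirr : Irr W p) {d : ℚ}
    (hd : d ≠ 0) (Wd : WeierstrassCurve ℚ) [Wd.IsElliptic] [Wd.IsGloballyMinimal] (Cd : VariableChange ℚ)
    (hCd : Cd • W.quadraticTwist d = Wd) (hmult : Mult Wd p) (hram : Ram Wd p)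
    (hL : Wd.entireLFunction 1 ≠ 0) : RowC1 Wd p :=
  ⟨analyticRank_eq_zero_of_entireLFunction_one_ne_zero hL, hp, Or.inr hmult,
    irr_twist_model W p hirr hd Cd hCd, hram⟩

/-- **`BSD(Wd, p)` for the ramified twin** (Miller's `BSDp`), from Skinner 2016 Thm. C (`hSk`), modularity
(`hmod`: `L(Wd, s)` entire, to read `r_an = 0`) and Gross–Zagier–Kolyvagin (`hGZK`: rank `0`, `Ш` finite) —
`RowC1.bsdp` at the row-C1 pair `rowC1_twist`. [cite: Skinner2016PacificMC, Thm. C (§1)]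
[cite: Miller2011LMS, Def. 1.1] -/
theorem twinBSDp_of_thmC (hSk : Skinner2016.thmC_padicValRat_bsd_rank_zero) (hmod : hasEntireLFunction_rat)
    (hGZK : rank_eq_analyticRank_of_analyticRank_le_one)
    (W : WeierstrassCurve ℚ) (p : ℕ) [Fact p.Prime] (hp : 3 ≤ p) (hirr : Irr W p) {d : ℚ}
    (hd : d ≠ 0) (Wd : WeierstrassCurve ℚ) [Wd.IsElliptic] [Wd.IsGloballyMinimal] (Cd : VariableChange ℚ)
    (hCd : Cd • W.quadraticTwist d = Wd) (hmult : Mult Wd p) (hram : Ram Wd p)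
    (hL : Wd.entireLFunction 1 ≠ 0) : BSDp Wd p :=
  RowC1.bsdp hSk hmod hGZK (rowC1_twist W p hp hirr hd Wd Cd hCd hmult hram hL)

/-- **The ramified twin's `p`-part in Miller's currency** (`Typed.MissingPPartAt Wd p`: `#Ш_an(Wd)` is a rational
`r` with `ord_p r = ord_p #Ш(Wd)`): `twinBSDp_of_thmC` read through `Typed.missingPPartAt_of_bsdp` (`Ш(Wd)` finite
by `hGZK`). [cite: Skinner2016PacificMC, Thm. C (§1)] [cite: Miller2011LMS, Def. 1.1] -/
theorem twinMissingPPartAt_of_thmC (hSk : Skinner2016.thmC_padicValRat_bsd_rank_zero)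
    (hmod : hasEntireLFunction_rat) (hGZK : rank_eq_analyticRank_of_analyticRank_le_one)
    (W : WeierstrassCurve ℚ) (p : ℕ) [Fact p.Prime] (hp : 3 ≤ p) (hirr : Irr W p) {d : ℚ}
    (hd : d ≠ 0) (Wd : WeierstrassCurve ℚ) [Wd.IsElliptic] [Wd.IsGloballyMinimal] (Cd : VariableChange ℚ)
    (hCd : Cd • W.quadraticTwist d = Wd) (hmult : Mult Wd p) (hram : Ram Wd p)
    (hL : Wd.entireLFunction 1 ≠ 0) : MissingPPartAt Wd p := by
  haveI : Finite Wd.sha :=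
    (hGZK Wd (by rw [analyticRank_eq_zero_of_entireLFunction_one_ne_zero hL]; exact zero_le_one)).2
  exact missingPPartAt_of_bsdp Wd p (twinBSDp_of_thmC hSk hmod hGZK W p hp hirr hd Wd Cd hCd hmult hram hL)

/-- **The ramified twin's LOWER half** (`Typed.MissingLowerBoundAt Wd p`: `ord_p #Ш_an(Wd) ≤ ord_p #Ш(Wd)`) — the
slot of the S1b core that line `birth` v17 fills with the route crux `X11aLowerHalf` (`h₃ Wd p hXa` at an X11a
twin), here a THEOREM modulo print for a twin carrying a (ram) witness: Skinner 2016 Thm. C (`hSk`) + modularity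
(`hmod`) + GZK (`hGZK`), `E[p]` irreducible, `3 ≤ p`, `Wd = Cd • E^{(d)}` (`d ≠ 0`) multiplicative at `p` with
`Ram Wd p` and `L(Wd,1) ≠ 0`. [cite: Skinner2016PacificMC, Thm. C (§1)] [cite: Miller2011LMS, Def. 1.1] -/
theorem twinMissingLowerBoundAt_of_thmC (hSk : Skinner2016.thmC_padicValRat_bsd_rank_zero)
    (hmod : hasEntireLFunction_rat) (hGZK : rank_eq_analyticRank_of_analyticRank_le_one)
    (W : WeierstrassCurve ℚ) (p : ℕ) [Fact p.Prime] (hp : 3 ≤ p) (hirr : Irr W p) {d : ℚ}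
    (hd : d ≠ 0) (Wd : WeierstrassCurve ℚ) [Wd.IsElliptic] [Wd.IsGloballyMinimal] (Cd : VariableChange ℚ)
    (hCd : Cd • W.quadraticTwist d = Wd) (hmult : Mult Wd p) (hram : Ram Wd p)
    (hL : Wd.entireLFunction 1 ≠ 0) : MissingLowerBoundAt Wd p :=
  (lower_and_upper_of_missingPPartAt Wd p
    (twinMissingPPartAt_of_thmC hSk hmod hGZK W p hp hirr hd Wd Cd hCd hmult hram hL)).1

/-- **The served frame's lower half, in the card's binders** (`d : ℤ` with `padicValInt q d = 1`, the first
lemma `RamTwistOfPotMultRamified` as the hypothesis `hRamTwist`, `5 ≤ p`): `Typed.MissingLowerBoundAt Wd p` for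
the ramified twin — the statement a re-keyed S1b consumer would take in place of `X11aLowerHalf` on the served
sub-population (odd additive potentially multiplicative `q` with `p ∤ ord_q j`).
[cite: Skinner2016PacificMC, Thm. C (§1)] [cite: Miller2011LMS, Def. 1.1] -/
theorem twinMissingLowerBoundAt_of_thmC_of_ramTwist (hSk : Skinner2016.thmC_padicValRat_bsd_rank_zero)
    (hmod : hasEntireLFunction_rat) (hGZK : rank_eq_analyticRank_of_analyticRank_le_one)
    (hRamTwist : ∀ (W : WeierstrassCurve ℚ) [W.IsElliptic] [W.IsGloballyMinimal] (p q : ℕ) [Fact p.Prime]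
      [Fact q.Prime] (d : ℤ) (Wd : WeierstrassCurve ℚ) [Wd.IsElliptic] [Wd.IsGloballyMinimal]
      (Cd : WeierstrassCurve.VariableChange ℚ),
      q ≠ 2 → q ≠ p → Addv W q → Additive.PotMult W q → padicValInt q d = 1 →
      Cd • W.quadraticTwist (d : ℚ) = Wd → ¬ (p : ℤ) ∣ padicValRat q W.j →
      Mult Wd q ∧ padicValInt q Wd.minimalDiscriminantInt = - padicValRat q W.j ∧ Ram Wd p)
    (W : WeierstrassCurve ℚ) [W.IsElliptic] [W.IsGloballyMinimal] (p q : ℕ) [Fact p.Prime] [Fact q.Prime]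
    (d : ℤ) (Wd : WeierstrassCurve ℚ) [Wd.IsElliptic] [Wd.IsGloballyMinimal] (Cd : WeierstrassCurve.VariableChange ℚ)
    (hp : 5 ≤ p) (hq2 : q ≠ 2) (hqp : q ≠ p) (hirr : Irr W p) (hadd : Addv W q) (hpot : Additive.PotMult W q)
    (hd : padicValInt q d = 1) (hCd : Cd • W.quadraticTwist (d : ℚ) = Wd)
    (hndvd : ¬ (p : ℤ) ∣ padicValRat q W.j) (hmult : Mult Wd p) (hL : Wd.entireLFunction 1 ≠ 0) :
    MissingLowerBoundAt Wd p := by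
  obtain ⟨-, -, hram⟩ := hRamTwist W p q d Wd Cd hq2 hqp hadd hpot hd hCd hndvd
  exact twinMissingLowerBoundAt_of_thmC hSk hmod hGZK W p (by omega) hirr
    (cast_ne_zero_of_padicValInt_eq_one hd) Wd Cd hCd hmult hram hL

end Summit.BirchSwinnertonDyer.BirchSwinnertonDyer.Theorems.RamifiedTwinRamTransport

end
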